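import Mathlib
import Summits.Ventures.PercRepro2.TB14CutSplit

/-!
# Pockets, I: the bypass lemma and the product law for an edge partition
(blind cell PercRepro2, mine-c g16, 2026-08-25; `proofs/MINEC-TB14BLOCK.md` §10)

A POCKET between `c` and `d` is a vertex set `VP ∌ c, d` together with its edge set `EP` (every
edge with an endpoint in `VP`), every such edge having both endpoints in `VP ∪ {c, d}`.  Every
connection between vertices outside the pocket sees the pocket only through the LINK `c ↔ d`
inside it (`conn_pocket_iff`: the pocket is replaced by one edge `g` of it, re-attached at `c, d`
and set to the link).  `pairCount_mul_of_parts`: the product law of `TB14CutSplit` for ANY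
partition of the edges (the cut structure is witnessed on an auxiliary graph).  Own work;
standard axioms.
-/

namespace Summit.Ventures.PercRepro2

namespace TB14Cut

open CovForm A3InactiveTyped CutV

/-! ## Pockets -/

section Pocket

variable {V : Type*} {E : Type*}

/-- A pocket between `c` and `d`: interior `VP`, pocket edges `EP` (the edges touching `VP`, all
inside `VP ∪ {c, d}`), the other edges `EL`. -/
structure IsPocket (ends : E → Sym2 V) (c d : V) (VP : Set V) (EP EL : Set E) : Prop where
  /-- `c` is not interior. -/
  c_notMem : c ∉ VP
  /-- `d` is not interior. -/
  d_notMem : d ∉ VP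
  /-- The pocket edges are exactly the edges touching the interior. -/
  mem_EP : ∀ e, e ∈ EP ↔ ∃ v ∈ VP, v ∈ ends e
  /-- A pocket edge has both endpoints in `VP ∪ {c, d}`. -/
  ends_sub : ∀ e ∈ EP, ∀ v ∈ ends e, v ∈ VP ∨ v = c ∨ v = d
  /-- Every edge is a pocket edge or an `L`-edge. -/
  cover : ∀ e, e ∈ EP ∨ e ∈ EL
  /-- No edge is both. -/
  disj : Disjoint EP EL

variable {ends : E → Sym2 V} {c d : V} {VP : Set V} {EP EL : Set E}

/-- An `L`-edge has no interior endpoint. -/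
lemma IsPocket.notMem_of_mem_EL (hp : IsPocket ends c d VP EP EL) {e : E} (he : e ∈ EL) {v : V}
    (hv : v ∈ ends e) : v ∉ VP :=
  fun hvP => Set.disjoint_left.1 hp.disj ((hp.mem_EP e).2 ⟨v, hvP, hv⟩) he

/-- The `L`-edges are the edges off `EP`. -/
lemma IsPocket.mem_EL_iff (hp : IsPocket ends c d VP EP EL) (e : E) : e ∈ EL ↔ e ∉ EP := by
  constructor
  · intro heL heP
    exact Set.disjoint_left.1 hp.disj heP heL
  · intro heP
    rcases hp.cover e with h | h
    · exact absurd h heP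
    · exact h

end Pocket

/-! ## The bypass: connections outside the pocket see only the link -/

section Bypass

variable {V : Type*} {E : Type*} [DecidableEq E] {ends : E → Sym2 V} {c d : V} {VP : Set V}
  {EP EL : Set E} [DecidablePred (· ∈ EP)] [DecidablePred (· ∈ EL)]

/-- The link of the pocket: `c ↔ d` inside the pocket. -/
def linkP (ends : E → Sym2 V) (EP : Set E) [DecidablePred (· ∈ EP)] (c d : V) (y : Config E) :
    Prop := Conn ends (restrict EP y) c d

omit [DecidableEq E] in
/-- The pocket configuration is below the configuration. -/
lemma conn_restrict_EP_le {y : Config E} {x x' : V} (h : Conn ends (restrict EP y) x x') :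
    Conn ends y x x' := conn_mono (restrict_le EP y) h

/-- **The bypass lemma.** For `x, x'` outside the pocket and any pocket edge `g`: `x ↔ x'` in
`(ends, y)` iff `x ↔ x'` in the `L`-graph with `g` re-attached at `c, d` and set to the link. -/
theorem conn_pocket_iff (hp : IsPocket ends c d VP EP EL) {g : E} (hg : g ∈ EP) (y : Config E)
    (ℓ : Bool) (hℓ : ℓ = true ↔ linkP ends EP c d y) {x x' : V} (hx : x ∉ VP) (hx' : x' ∉ VP) :
    Conn ends y x x' ↔
      Conn (Function.update ends g s(c, d)) (Function.update (restrict EL y) g ℓ) x x' := by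
  set ends' := Function.update ends g s(c, d) with hends'
  set y' := Function.update (restrict EL y) g ℓ with hy'
  have hgL : g ∉ EL := fun h => Set.disjoint_left.1 hp.disj hg h
  -- the link gives the edge `g`, the edge `g` gives the link
  have hlink_of : linkP ends EP c d y → Conn ends' y' c d := by
    intro hl
    have : y' g = true := by rw [hy', Function.update_self]; exact hℓ.2 hl
    exact conn_of_openAdj ⟨g, this, by rw [hends', Function.update_self]⟩
  constructor
  · intro h
    -- closure: outside vertices reached in `L`, inside vertices reached in the pocket from a
    -- reached boundary vertex
    let S : Set V := {t | (t ∉ VP ∧ Conn ends' y' x t) ∨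
      (t ∈ VP ∧ ∃ u, (u = c ∨ u = d) ∧ Conn ends' y' x u ∧ Conn ends (restrict EP y) u t)}
    have hxS : x ∈ S := Or.inl ⟨hx, conn_refl _ _ _⟩
    have hclosed : ∀ t ∈ S, ∀ t', (openGraph ends y).Adj t t' → t' ∈ S := by
      intro t ht t' htt'
      obtain ⟨_, e, he, hends⟩ := openGraph_adj.1 htt'
      have ht_mem : t ∈ ends e := by rw [hends]; exact Sym2.mem_mk_left _ _
      have ht'_mem : t' ∈ ends e := by rw [hends]; exact Sym2.mem_mk_right _ _
      by_cases heP : e ∈ EP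
      · -- a pocket edge: both ends in `VP ∪ {c, d}`
        have hsub := hp.ends_sub e heP
        have heP' : restrict EP y e = true := by rw [restrict_apply_of_mem heP]; exact he
        have hconn_tt' : Conn ends (restrict EP y) t t' := conn_of_openAdj ⟨e, heP', hends⟩
        -- a reached boundary vertex `u` with `u ↔ t` in the pocket
        have hbd : ∃ u, (u = c ∨ u = d) ∧ Conn ends' y' x u ∧ Conn ends (restrict EP y) u t := by
          rcases ht with ⟨htP, hxt⟩ | ⟨_, u, hu, hxu, hut⟩
          · rcases hsub t ht_mem with h1 | h1 | h1
            · exact absurd h1 htP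
            · exact ⟨c, Or.inl rfl, h1 ▸ hxt, h1 ▸ conn_refl _ _ _⟩
            · exact ⟨d, Or.inr rfl, h1 ▸ hxt, h1 ▸ conn_refl _ _ _⟩
          · exact ⟨u, hu, hxu, hut⟩
        obtain ⟨u, hu, hxu, hut⟩ := hbd
        have hut' : Conn ends (restrict EP y) u t' := conn_trans hut hconn_tt'
        rcases hsub t' ht'_mem with h1 | h1 | h1
        · exact Or.inr ⟨h1, u, hu, hxu, hut'⟩
        · -- `t' = c`
          subst h1
          refine Or.inl ⟨hp.c_notMem, ?_⟩
          rcases hu with rfl | rfl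
          · exact hxu
          · exact conn_trans hxu (conn_symm (hlink_of (conn_symm hut')))
        · -- `t' = d`
          subst h1
          refine Or.inl ⟨hp.d_notMem, ?_⟩
          rcases hu with rfl | rfl
          · exact conn_trans hxu (hlink_of hut')
          · exact hxu
      · -- an `L`-edge: both ends outside the pocket, open in `y'` with the same ends
        have heL : e ∈ EL := (hp.mem_EL_iff e).2 heP
        have hne : e ≠ g := fun h => heP (h ▸ hg)
        have htP : t ∉ VP := hp.notMem_of_mem_EL heL ht_mem
        have ht'P : t' ∉ VP := hp.notMem_of_mem_EL heL ht'_mem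
        have hxt : Conn ends' y' x t := by
          rcases ht with ⟨_, h⟩ | ⟨h, _⟩
          · exact h
          · exact absurd h htP
        have hy'e : y' e = true := by
          rw [hy', Function.update_of_ne hne, restrict_apply_of_mem heL]; exact he
        have hends'e : ends' e = s(t, t') := by rw [hends', Function.update_of_ne hne]; exact hends
        exact Or.inl ⟨ht'P, conn_trans hxt (conn_of_openAdj ⟨e, hy'e, hends'e⟩)⟩
    have hx'S : x' ∈ S := mem_of_conn_of_closed hclosed hxS h
    rcases hx'S with ⟨_, h⟩ | ⟨h, _⟩
    · exact h
    · exact absurd h hx'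
  · intro h
    refine mem_of_conn_of_closed (S := {t | Conn ends y x t}) ?_ (conn_refl _ _ _) h
    intro t ht t' htt'
    obtain ⟨_, e, he, hends⟩ := openGraph_adj.1 htt'
    by_cases heg : e = g
    · -- the re-attached edge: open iff the link holds
      subst heg
      rw [hy', Function.update_self] at he
      rw [hends', Function.update_self] at hends
      have hcd : Conn ends y c d := conn_restrict_EP_le (hℓ.1 he)
      rw [Sym2.eq_iff] at hends
      rcases hends with ⟨rfl, rfl⟩ | ⟨rfl, rfl⟩
      · exact conn_trans ht hcd
      · exact conn_trans ht (conn_symm hcd)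
    · rw [hy', Function.update_of_ne heg] at he
      rw [hends', Function.update_of_ne heg] at hends
      have := restrict_eq_true_iff.1 he
      exact conn_trans ht (conn_of_openAdj ⟨e, this.1, hends⟩)

end Bypass

/-! ## The product law across an edge partition -/

section Parts

variable {E : Type*} [Fintype E] [DecidableEq E] {R : Type*} [CommRing R]
  {EA EB : Set E} [DecidablePred (· ∈ EA)] [DecidablePred (· ∈ EB)]

/-- **Product law for an edge partition**: `pairCount_mul_of_cut` only uses that `EA, EB`
partition the edges (the cut structure is witnessed on an auxiliary graph). -/
theorem pairCount_mul_of_parts (hcover : ∀ e, e ∈ EA ∨ e ∈ EB) (hdisj : Disjoint EA EB)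
    (F : Finset E) (z : Config E) (f g : Config E → Config E → R)
    (hf : ∀ y w, f y w = f (restrict EA y) (restrict EA w))
    (hg : ∀ y w, g y w = g (restrict EB y) (restrict EB w)) :
    pairCount F z (fun y w => f y w * g y w) =
      pairCount (sideFree EA F) (restrict EA z) f * pairCount (sideFree EB F) (restrict EB z) g := by
  -- an auxiliary graph on `Option Bool` in which `EA` are loops at `some true` and `EB` loops at
  -- `some false`; `none` is the «cut vertex»
  let ends₀ : E → Sym2 (Option Bool) := fun e =>
    if e ∈ EA then s(some true, some true) else s(some false, some false)
  have hcut : IsCut ends₀ none {some true} {some false} EA EB :=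
    { disj := by simp
      x_notA := by simp
      x_notB := by simp
      EA_sub := by
        intro e he
        refine ⟨some true, Or.inl rfl, some true, Or.inl rfl, ?_⟩
        simp [ends₀, he]
      EB_sub := by
        intro e he
        have : e ∉ EA := fun h => Set.disjoint_left.1 hdisj h he
        refine ⟨some false, Or.inl rfl, some false, Or.inl rfl, ?_⟩
        simp [ends₀, this]
      cover := hcover
      Edisj := hdisj }
  exact pairCount_mul_of_cut hcut F z f g hf hg

end Parts

end TB14Cut

end Summit.Ventures.PercRepro2
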